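import Literature.NumberTheory.Automorphic.QuaternionUnitsTraceHS
import Literature.MeasureTheory.Group.InvariantQuotientNormalized
import HarnessLib

/-!
# The trace formula for `D^×` with the printed constants:
`Σ_i ‖R(f) e_i‖² = Σ_{[γ]} vol(G_γ ⧸ ℝ_{>0} Dˣ_γ) ∫_{G ⧸ G_γ} (f ⋆ f^*)_A(y γ y⁻¹) d(ν/ν_γ)(y)`
(Gelbart, *Automorphic forms on adele groups* (1975), Remark 9.23 (p. 140) and (10.14) (p. 154))

Topic `NumberTheory/Automorphic`; theorems only (no definition, no named fact, no instance). Part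
of the inline (D-0026) decomposition of
`Literature.NumberTheory.Automorphic.strong_multiplicity_one_quaternionUnits` (Gelbart Thm. 10.5
(ii) with Thm. 10.10), whose printed proof compares the trace formula (10.14) for the
multiplicative group `G' = D^×` of a division quaternion algebra with the simple trace formula
(10.15) for `GL(2)` **term by term, with Tamagawa measures on both sides** (p. 155: "Tamagawa
measures being taken on both sides"). The tree's `D^×` side
(`QuaternionUnitsTraceHS.units_hasSum_norm_sq_integratedOperator_rightRegular_eq_geometric`, on
`QuaternionUnitsTraceClasses` and `AutomorphicQuotientKernelGeometric`) was proved only with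
*unspecified* constants — `c⁻¹ κ Σ_c d_c ∫ … dμ_c` with `d_c ∈ (0, ∞)` and `μ_c` *some* invariant
measure ("CAVEAT: constants and measures are not normalised") — which cannot enter a term-by-term
comparison. This file proves the `D^×` trace formula in Hilbert–Schmidt form **with the printed
constants** (`units_hasSum_norm_sq_integratedOperator_eq_tsum_covol_mul`): for `D` a division
quaternion algebra over a number field `K`, `G = D_𝔸ˣ`, `X = G ⧸ ℝ_{>0} Dˣ` with an automorphic
measure `μ`, Haar measures `ν` on `G` and `α` on `ℝ_{>0}`, and for each conjugacy class `[γ]` of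
`Dˣ` a Haar measure `ν_γ` on the centraliser `G_γ = C_G(γ)`,

  `Σ_i ‖R(f) e_i‖² = Σ'_{[γ]} vol(G_γ ⧸ ℝ_{>0} Dˣ_γ) · ∫_{G ⧸ G_γ} (f ⋆ f^*)_A(y γ y⁻¹) d(ν/ν_γ)(y)`

for every `f ∈ C_c(G)` and every Hilbert basis `(e_i)` of `L²(X, μ)`, where
`R(f) = ∫_G f(g) R(g) dν(g)`, `Φ_A(g) = ∫_{ℝ_{>0}} Φ(a⁻¹ g) dα(a)`, `ν/ν_γ = quotientMeasure G_γ ν_γ ν`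
is the quotient measure with Weil constant one, and `vol(G_γ ⧸ ℝ_{>0} Dˣ_γ)` is the total mass of the
quotient measure of `G_γ` by `H_γ = ℝ_{>0} Dˣ ∩ G_γ` for `ν_γ` and the restriction to `H_γ` of the Haar
measure `α ⊗ counting` of `ℝ_{>0} Dˣ` — Gelbart's `meas(Z_∞⁺ G(γ)_ℚ \ G(γ)_𝔸)`. No unspecified constant
is left: the normalisations of `μ` and of the Haar measure of `ℝ_{>0} Dˣ` cancel, those of the
`ν_γ` cancel between volume and orbital integral, and the left-hand side depends on `ν` only.

Contents:

* `isMulRightInvariant_of_comm`, `isMulRightInvariant_of_map_mulEquiv` — two lemmas of abstract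
  harmonic analysis (a left Haar measure on a commutative subgroup is right invariant; right
  invariance descends along a measurable group isomorphism);
* `units_isMulRightInvariant_centralizer`, `units_isInvInvariant_centralizer` — every Haar
  measure on a centraliser `G_γ`, `γ ∈ Dˣ`, is two-sided and inversion invariant (regular `γ`:
  the torus `K(γ)_𝔸ˣ` is abelian, `centralizer_inclAdelic_comm`; central `γ`: `G_γ = G` is
  unimodular, `units_isMulRightInvariant_of_isHaarMeasure`);
* `units_lintegral_conjTsum_eq_mul_tsum_covol_mul` — the `[0, ∞]`-valued geometric side with the
  printed volumes for an arbitrary automorphic `μ` (factor `c_μ = unfoldingConstant L ρ₀ μ ν`), from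
  `Literature.MeasureTheory.Group.lintegral_conjTsum_eq_mul_tsum_covol_mul`
  (`InvariantQuotientNormalized`) and the per-class inputs of `QuaternionUnitsTraceClasses`
  (centralisers closed, `G_γ ⧸ H_γ` compact, `H_γ` relatively open in `L`);
* `units_exists_restricted_haar` — the restricted Haar measures `(α ⊗ counting)|_{H_γ}` and their
  transports to `H_γ ≤ G_γ` exist with the required invariance (non-vacuity of the parameters);
* `units_hasSum_norm_sq_integratedOperator_eq_tsum_covol_mul` — **the theorem**, assembled from
  `hasSum_norm_sq_integratedOperator_rightRegular_eq_diagonal` (Gelbart (9.11) with Lemma 10.6: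
  `Σ_i ‖R(f) e_i‖² = c⁻¹ ∫_X K_{f⋆f^*}(x, x) dμ`), `integral_quotientKernel_diag_eq_mul_tsum`
  (absolute convergence, passage to `ℂ`) and the previous item;
* `units_tsum_enorm_sq_integratedOperator_eq_ofReal` — the same in `[0, ∞]`:
  `Σ'_l ‖R(f) e_l‖ₑ² = ofReal (re V(f))` with `V(f)` the geometric side, which is real
  (`tsum_ofReal_eq_ofReal_re_of_hasSum`) — the shape consumed by the spectral decomposition
  theorems of `HilbertRepHilbertSchmidtBlocks` (`Σ_l ‖π(f) e_l‖ₑ² = Σ_{W ∈ S} ‖π(f)|_W‖²_{HS}`,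
  `= Σ_σ m(σ) ‖σ(f)‖²_{HS}`), i.e. both sides of Gelbart's (10.14) for `Φ' = f ⋆ f^*`.

Design. The measures `ν_γ` on the centralisers and the restricted measures `ρ_{H,γ}`, `ρ_{F,γ}`
are parameters carrying their invariance properties as instance binders, tied to `α` by the
equations `hρH`, `hρF` (so that the quotient measures in the statement elaborate); the binders are
dischargeable (`units_isMulRightInvariant_centralizer`, `units_isInvInvariant_centralizer`,
`units_exists_restricted_haar`), as are the topological binders (`units_adelic_topology`,
`isClosed_quotientSubgroup_units`, `isClosed_centralizer_singleton`). Not treated here: the spectral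
side `Σ_π m(π) tr π(f) π(f)^*` (`HilbertRepHilbertSchmidtBlocks`), the identification of the volumes
with Tamagawa numbers, and the `GL(2)` side (10.15).

## References

* S. Gelbart, *Automorphic forms on adele groups*, Ann. of Math. Studies 83 (1975), (9.11)–(9.13)
  (p. 118), Remark 9.23 (p. 140), Lemma 10.6, (10.14) (p. 154), p. 155 [Gelbart1975].
-/

noncomputable section

open NumberField IsDedekindDomain MeasureTheory Measure Topology
open Literature.MeasureTheory.Group
open scoped NNReal ENNReal TensorProduct Pointwise

namespace Literature.NumberTheory.Automorphic

-- the coset spaces carry Borel σ-algebras supplied locally, not the quotient σ-algebra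
attribute [-instance] Quotient.instMeasurableSpace QuotientGroup.measurableSpace

universe u

/-! ### Two lemmas of abstract harmonic analysis -/

section General

/-- **On a commutative subgroup a left-invariant measure is right invariant** (right and left
translations agree). [folklore] -/
theorem isMulRightInvariant_of_comm {G : Type*} [Group G] [MeasurableSpace G] (M : Subgroup G) (hcomm : ∀ x ∈ M, ∀ y ∈ M, x * y = y * x)
    (ρ : Measure M) [ρ.IsMulLeftInvariant] : ρ.IsMulRightInvariant := by
  refine ⟨fun g => ?_⟩
  have h : (fun x : M => x * g) = fun x => g * x :=
    funext fun x => Subtype.ext (hcomm x x.2 g g.2)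
  rw [h]
  exact map_mul_left_eq_self ρ g

/-- **Right invariance descends along an isomorphism of measurable groups**: if `e : A ≃* B` is a
measurable equivalence and `e_* μ` is right invariant, so is `μ`. [folklore] -/
theorem isMulRightInvariant_of_map_mulEquiv {A B : Type*} [Group A] [Group B] [MeasurableSpace A]
    [MeasurableSpace B] [MeasurableMul A] [MeasurableMul B] (e : A ≃* B) (he : Measurable e)
    (hes : Measurable e.symm) (μ : Measure A) (h : (Measure.map e μ).IsMulRightInvariant) :
    μ.IsMulRightInvariant := by
  set e' : A ≃ᵐ B := ⟨e.toEquiv, he, hes⟩ with he'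
  refine ⟨fun a => ?_⟩
  apply e'.map_measurableEquiv_injective
  change Measure.map e (Measure.map (fun x => x * a) μ) = Measure.map e μ
  rw [Measure.map_map he (measurable_mul_const a)]
  have h1 : (e : A → B) ∘ (fun x => x * a) = (fun y => y * e a) ∘ (e : A → B) := by
    funext x
    simp only [Function.comp_apply, map_mul]
  rw [h1, ← Measure.map_map (measurable_mul_const (e a)) he]
  exact h.map_mul_right_eq_self (e a)

end General

/-! ### From a complex `HasSum` of squared norms to the `[0, ∞]`-valued Hilbert–Schmidt sum -/

section HasSumToENNReal

/-- If `Σ_i (a_i : ℂ)` converges to `V` for real `a_i ≥ 0`, then `Σ'_i ofReal(a_i) = ofReal(re V)`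
in `[0, ∞]` and `V` is real (`im V = 0`). [folklore] -/
theorem tsum_ofReal_eq_ofReal_re_of_hasSum {ι : Type*} {a : ι → ℝ} (ha : ∀ i, 0 ≤ a i) {V : ℂ}
    (h : HasSum (fun i => ((a i : ℝ) : ℂ)) V) :
    ∑' i, ENNReal.ofReal (a i) = ENNReal.ofReal V.re ∧ V.im = 0 := by
  have hre : HasSum a V.re := by
    have := h.mapL Complex.reCLM
    simpa only [Complex.reCLM_apply, Complex.ofReal_re] using this
  have him : HasSum (fun _ : ι => (0 : ℝ)) V.im := by
    have := h.mapL Complex.imCLM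
    simpa only [Complex.imCLM_apply, Complex.ofReal_im] using this
  refine ⟨?_, (hasSum_zero.unique him).symm⟩
  rw [← hre.tsum_eq, ENNReal.ofReal_tsum_of_nonneg ha hre.summable]

end HasSumToENNReal

/-! ### Haar measures on the centralisers `G_γ = C_{D_𝔸ˣ}(γ)`, `γ ∈ Dˣ` -/

section Centralizer

variable (K : Type) [Field K] [NumberField K] (D : Type u) [Ring D] [Algebra K D]
  [IsQuaternionAlgebra K D]
  [MeasurableSpace (AdelicGroupData.units K D).Adelic] [BorelSpace (AdelicGroupData.units K D).Adelic]

local notation "GD" => AdelicGroupData.units K D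

/-- **Every Haar measure on a centraliser `G_γ = C_{D_𝔸ˣ}(γ)` of a rational `γ ∈ Dˣ` is right
invariant**: for regular `γ` the centraliser is abelian (`centralizer_inclAdelic_comm`, the torus
`K(γ)_𝔸ˣ`); for central `γ` it is all of `D_𝔸ˣ`, which is unimodular
(`units_isMulRightInvariant_of_isHaarMeasure`). (Gelbart (1975), Remark 9.23: the measures on
`G(γ)_𝔸` in `meas(Z_∞⁺ G(γ)_ℚ \ G(γ)_𝔸) ∫_{G(γ)_𝔸 \ G_𝔸}` are Haar measures of unimodular groups.)
[cite: Gelbart1975, Remark 9.23] -/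
theorem units_isMulRightInvariant_centralizer (hdiv : ∀ x : D, x ≠ 0 → IsUnit x)
    {γ : (GD).Adelic} (hγ : γ ∈ (GD).arithmeticSubgroup)
    (ν₀ : Measure (Subgroup.centralizer ({γ} : Set (GD).Adelic))) [IsHaarMeasure ν₀] :
    ν₀.IsMulRightInvariant := by
  obtain ⟨d, rfl⟩ := hγ
  have h4 : Module.finrank K D = 4 := IsQuaternionAlgebra.finrank_eq_four (K := K) (D := D)
  haveI : Nontrivial D := Module.nontrivial_of_finrank_pos (R := K) (by omega)
  obtain ⟨i₁, i₂, i₃⟩ := units_adelic_topology K D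
  haveI := i₁; haveI := i₂; haveI := i₃
  rcases units_mem_bot_or_not K D d with ⟨c, hc⟩ | hd
  · -- central: `G_γ = ⊤ ≃ D_𝔸ˣ`, unimodular
    have htop : Subgroup.centralizer ({(GD).toAdelic d} : Set (GD).Adelic) = ⊤ :=
      units_centralizer_eq_top_of_eq_algebraMap K D hc
    set e : Subgroup.centralizer ({(GD).toAdelic d} : Set (GD).Adelic) ≃* (GD).Adelic :=
      (MulEquiv.subgroupCongr htop).trans Subgroup.topEquiv with he
    have hec : Continuous e := continuous_subtype_val
    have hesc : Continuous e.symm := by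
      refine Continuous.subtype_mk continuous_id _
    haveI : IsHaarMeasure (Measure.map e ν₀) := MulEquiv.isHaarMeasure_map ν₀ e hec hesc
    haveI : (Measure.map e ν₀).IsMulRightInvariant :=
      units_isMulRightInvariant_of_isHaarMeasure K D hdiv _
    exact isMulRightInvariant_of_map_mulEquiv e hec.measurable hesc.measurable ν₀ inferInstance
  · -- regular: abelian centraliser
    exact isMulRightInvariant_of_comm (Subgroup.centralizer ({(GD).toAdelic d} : Set (GD).Adelic))
      (centralizer_inclAdelic_comm K D hdiv h4 d hd) ν₀

/-- **Every Haar measure on a centraliser `G_γ`, `γ ∈ Dˣ`, is inversion invariant** (right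
invariant by `units_isMulRightInvariant_centralizer`, and `G_γ` is a closed subgroup of the second
countable locally compact `D_𝔸ˣ`, `isInvInvariant_of_isMulRightInvariant`).
[cite: Gelbart1975, Remark 9.23] -/
theorem units_isInvInvariant_centralizer (hdiv : ∀ x : D, x ≠ 0 → IsUnit x)
    {γ : (GD).Adelic} (hγ : γ ∈ (GD).arithmeticSubgroup)
    (ν₀ : Measure (Subgroup.centralizer ({γ} : Set (GD).Adelic))) [IsHaarMeasure ν₀] :
    ν₀.IsInvInvariant := by
  obtain ⟨i₁, i₂, i₃⟩ := units_adelic_topology K D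
  haveI := i₁; haveI := i₂; haveI := i₃
  haveI : IsClosed ((Subgroup.centralizer ({γ} : Set (GD).Adelic) : Subgroup (GD).Adelic) :
    Set (GD).Adelic) := isClosed_centralizer_singleton _
  haveI := units_isMulRightInvariant_centralizer K D hdiv hγ ν₀
  exact isInvInvariant_of_isMulRightInvariant ν₀

end Centralizer

/-! ### The geometric side for `D^×` with the printed volumes -/

section Normalized

variable (K : Type) [Field K] [NumberField K] (D : Type u) [Ring D] [Algebra K D]
  [IsQuaternionAlgebra K D]
  [MeasurableSpace (AdelicGroupData.units K D).Adelic] [BorelSpace (AdelicGroupData.units K D).Adelic]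
  [∀ γ : (AdelicGroupData.units K D).Adelic, MeasurableSpace ((AdelicGroupData.units K D).Adelic ⧸
    Subgroup.centralizer ({γ} : Set (AdelicGroupData.units K D).Adelic))]
  [∀ γ : (AdelicGroupData.units K D).Adelic, BorelSpace ((AdelicGroupData.units K D).Adelic ⧸
    Subgroup.centralizer ({γ} : Set (AdelicGroupData.units K D).Adelic))]
  [∀ γ : (AdelicGroupData.units K D).Adelic, MeasurableSpace
    (↥(Subgroup.centralizer ({γ} : Set (AdelicGroupData.units K D).Adelic)) ⧸
      ((AdelicGroupData.units K D).quotientSubgroup ⊓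
        Subgroup.centralizer ({γ} : Set (AdelicGroupData.units K D).Adelic)).subgroupOf
        (Subgroup.centralizer ({γ} : Set (AdelicGroupData.units K D).Adelic)))]
  [∀ γ : (AdelicGroupData.units K D).Adelic, BorelSpace
    (↥(Subgroup.centralizer ({γ} : Set (AdelicGroupData.units K D).Adelic)) ⧸
      ((AdelicGroupData.units K D).quotientSubgroup ⊓
        Subgroup.centralizer ({γ} : Set (AdelicGroupData.units K D).Adelic)).subgroupOf
        (Subgroup.centralizer ({γ} : Set (AdelicGroupData.units K D).Adelic)))]

attribute [local instance] AdelicGroupData.measurableSpaceQuotientForm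
  AdelicGroupData.borelSpaceQuotientForm AdelicGroupData.smulInvariantMeasureQuotientForm
  AdelicGroupData.isFiniteMeasureOnCompactsQuotientForm AdelicGroupData.isFiniteMeasureQuotientForm

local notation "GD" => AdelicGroupData.units K D

/-- **The `[0, ∞]`-valued geometric side for `D^×` with the printed volumes** (Gelbart (1975),
Remark 9.23: for `X = Z_∞⁺ G_ℚ \ G_𝔸` compact, `tr R(f) = Σ_{{γ}} meas(Z_∞⁺ G(γ)_ℚ \ G(γ)_𝔸)
∫_{G(γ)_𝔸 \ G_𝔸} f(x⁻¹ γ x) dx`, "the summation extending over a complete set of representatives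
of the conjugacy classes in `G_ℚ`"). Let `D` be a division quaternion algebra over the number
field `K`, `𝒢 = AdelicGroupData.units K D` (`G = D_𝔸ˣ`, `Γ = Dˣ`, `L = ℝ_{>0} · Dˣ`), `μ` an
automorphic measure on `X = G ⧸ L`, `ν` a Haar measure on `G` and `ρ₀` one on `L`; for each
conjugacy class `c` of `Γ` let `γ_c = out c`, `G_c = C_G(γ_c)` (closed; a torus `K(γ_c)_𝔸ˣ` or all
of `G`), `H_c = L ∩ G_c` (`= ℝ_{>0} · Dˣ_{γ_c}`), `ν_c` a Haar measure on `G_c` (necessarily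
two-sided and inversion invariant, `units_isMulRightInvariant_centralizer`,
`units_isInvInvariant_centralizer`), `ρ_{H,c} = ρ₀|_{H_c}` the restriction (`Measure.comap` along
`H_c ↪ L`) and `ρ_{F,c}` its transport to `H_c ≤ G_c`. Then for every Borel `F : G → [0, ∞]`,

  `∫_X Σ'_{γ ∈ Γ} F(x̃ γ x̃⁻¹) dμ(x) = c_μ · Σ'_c vol(G_c ⧸ H_c) · ∫_{G ⧸ G_c} F(y γ_c y⁻¹) d(ν/ν_c)(y)`

with `c_μ = unfoldingConstant L ρ₀ μ ν` (Weil's constant of `μ`), `ν/ν_c = quotientMeasure G_c ν_c ν`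
(Weil constant one) and `vol(G_c ⧸ H_c)` the total mass of `quotientMeasure (H_c ⊓ G_c) ρ_{F,c} ν_c`
— Gelbart's `meas(Z_∞⁺ G(γ)_ℚ \ G(γ)_𝔸)` for the measures `ν_c` and `ρ₀|_{H_c}`
(`Literature.MeasureTheory.Group.lintegral_conjTsum_eq_mul_tsum_covol_mul` with the per-class
inputs of `QuaternionUnitsTraceClasses`). [cite: Gelbart1975, Remark 9.23] -/
theorem units_lintegral_conjTsum_eq_mul_tsum_covol_mul (hdiv : ∀ x : D, x ≠ 0 → IsUnit x)
    [LocallyCompactSpace (GD).Adelic] [SecondCountableTopology (GD).Adelic] [T2Space (GD).Adelic]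
    [hH : IsClosed ((GD).quotientSubgroup : Set (GD).Adelic)]
    [hCcl : ∀ γ : (GD).Adelic, IsClosed ((Subgroup.centralizer ({γ} : Set (GD).Adelic) :
      Subgroup (GD).Adelic) : Set (GD).Adelic)]
    (μ : Measure (GD).automorphicQuotient) [(GD).IsAutomorphicMeasure μ]
    (ν : Measure (GD).Adelic) [IsHaarMeasure ν] [ν.IsMulRightInvariant]
    (ρ₀ : Measure (GD).quotientSubgroup) [ρ₀.IsHaarMeasure] [SFinite ρ₀]
    (ρH : ∀ c : ConjClasses (GD).arithmeticSubgroup, Measure ↥((GD).quotientSubgroup ⊓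
      Subgroup.centralizer ({((Quotient.out c : (GD).arithmeticSubgroup) : (GD).Adelic)} :
        Set (GD).Adelic)))
    [∀ c, IsHaarMeasure (ρH c)] [∀ c, (ρH c).IsInvInvariant] [∀ c, SFinite (ρH c)]
    (ρF : ∀ c : ConjClasses (GD).arithmeticSubgroup, Measure ↥(((GD).quotientSubgroup ⊓
      Subgroup.centralizer ({((Quotient.out c : (GD).arithmeticSubgroup) : (GD).Adelic)} :
        Set (GD).Adelic)).subgroupOf (Subgroup.centralizer
          ({((Quotient.out c : (GD).arithmeticSubgroup) : (GD).Adelic)} : Set (GD).Adelic))))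
    [∀ c, IsHaarMeasure (ρF c)] [∀ c, (ρF c).IsInvInvariant] [∀ c, SFinite (ρF c)]
    (νC : ∀ c : ConjClasses (GD).arithmeticSubgroup, Measure ↥(Subgroup.centralizer
      ({((Quotient.out c : (GD).arithmeticSubgroup) : (GD).Adelic)} : Set (GD).Adelic)))
    [∀ c, IsHaarMeasure (νC c)] [∀ c, (νC c).IsMulRightInvariant] [∀ c, (νC c).IsInvInvariant]
    [∀ c, SFinite (νC c)]
    (hρH : ∀ c, ρH c = ρ₀.comap (Subgroup.inclusion inf_le_left))
    (hρF : ∀ c, ρF c = Measure.map (Subgroup.subgroupOfEquivOfLe inf_le_right).symm (ρH c))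
    {F : (GD).Adelic → ℝ≥0∞} (hF : Measurable F) :
    ∫⁻ x, conjTsum (GD).quotientSubgroup ((GD).arithmeticSubgroup : Set (GD).Adelic)
        (AdelicGroupData.conj_mem_arithmeticSubgroup (GD)) F x ∂μ =
      unfoldingConstant (GD).quotientSubgroup ρ₀ μ ν *
        ∑' c : ConjClasses (GD).arithmeticSubgroup,
          quotientMeasure (((GD).quotientSubgroup ⊓ Subgroup.centralizer
              ({((Quotient.out c : (GD).arithmeticSubgroup) : (GD).Adelic)} : Set (GD).Adelic)).subgroupOf
              (Subgroup.centralizer ({((Quotient.out c : (GD).arithmeticSubgroup) : (GD).Adelic)} :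
                Set (GD).Adelic))) (ρF c)
              (isClosed_subgroupOf _ _ (hH.inter (hCcl _))) (νC c) Set.univ *
            ∫⁻ y, descConj ((Quotient.out c : (GD).arithmeticSubgroup) : (GD).Adelic)
              (Subgroup.centralizer ({((Quotient.out c : (GD).arithmeticSubgroup) : (GD).Adelic)} :
                Set (GD).Adelic)) (mem_centralizer_singleton_comm _) F y
              ∂quotientMeasure (Subgroup.centralizer
                ({((Quotient.out c : (GD).arithmeticSubgroup) : (GD).Adelic)} : Set (GD).Adelic))
                (νC c) (hCcl _) ν := by
  have h4 : Module.finrank K D = 4 := IsQuaternionAlgebra.finrank_eq_four (K := K) (D := D)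
  haveI : Nontrivial D := Module.nontrivial_of_finrank_pos (R := K) (by omega)
  haveI : Countable (GD).arithmeticSubgroup := AdelicGroupData.countable_arithmeticSubgroup_units K D
  have hdisc : (GD).IsDiscreteRational := AdelicGroupData.units_isDiscreteRational_holds K D
  haveI : LocallyCompactSpace (AdeleRing (𝓞 K) K) := locallyCompactSpace_adeleRing' K
  obtain ⟨θ, hθc, hθA, hθa, hθγ⟩ := exists_centralRetraction_units K D
  have hrep : ∀ c : ConjClasses (GD).arithmeticSubgroup,
      ConjClasses.mk (Quotient.out c : (GD).arithmeticSubgroup) = c := fun c => by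
    rw [← ConjClasses.quotient_mk_eq_mk]; exact Quotient.out_eq c
  haveI : ∀ c : ConjClasses (GD).arithmeticSubgroup,
      IsClosed ((Subgroup.centralizer ({((Quotient.out c : (GD).arithmeticSubgroup) :
        (GD).Adelic)} : Set (GD).Adelic) : Subgroup (GD).Adelic) : Set (GD).Adelic) := fun c =>
    hCcl _
  haveI : ∀ c : ConjClasses (GD).arithmeticSubgroup,
      IsClosed ((((GD).quotientSubgroup ⊓ Subgroup.centralizer
        ({((Quotient.out c : (GD).arithmeticSubgroup) : (GD).Adelic)} : Set (GD).Adelic)) :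
          Subgroup (GD).Adelic) : Set (GD).Adelic) := fun c =>
    hH.inter (hCcl _)
  haveI : ∀ c : ConjClasses (GD).arithmeticSubgroup,
      CompactSpace (↥(Subgroup.centralizer ({((Quotient.out c : (GD).arithmeticSubgroup) :
        (GD).Adelic)} : Set (GD).Adelic)) ⧸ ((GD).quotientSubgroup ⊓
        Subgroup.centralizer ({((Quotient.out c : (GD).arithmeticSubgroup) : (GD).Adelic)} :
          Set (GD).Adelic)).subgroupOf (Subgroup.centralizer
            ({((Quotient.out c : (GD).arithmeticSubgroup) : (GD).Adelic)} : Set (GD).Adelic))) :=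
    fun c => units_compactSpace_centralizer_quotient K D hdiv (Quotient.out c).2
  exact Literature.MeasureTheory.Group.lintegral_conjTsum_eq_mul_tsum_covol_mul
    (GD).arithmeticSubgroup (GD).quotientSubgroup (GD).arithmeticSubgroup_le_quotientSubgroup
    (AdelicGroupData.exists_inv_mul_mem_centralizer_quotientSubgroup (GD))
    (fun c => Quotient.out c) hrep
    (fun c => (GD).quotientSubgroup ⊓ Subgroup.centralizer
      ({((Quotient.out c : (GD).arithmeticSubgroup) : (GD).Adelic)} : Set (GD).Adelic))
    (fun c => Subgroup.centralizer
      ({((Quotient.out c : (GD).arithmeticSubgroup) : (GD).Adelic)} : Set (GD).Adelic))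
    (fun c g => mem_inf_centralizer_singleton_iff _ _ _) (fun c => inf_le_right)
    (fun c => mem_centralizer_singleton_comm _) μ ν ρ₀ ρH ρF νC
    (fun c => AdelicGroupData.isOpen_subgroupOf_quotientSubgroup_of_center'_le (GD) hdisc θ hθc
      hθA hθa hθγ (AdelicGroupData.center'_le_inf_centralizer (GD) _))
    (AdelicGroupData.IsAutomorphicMeasure.ne_zero (GD) μ) hρH hρF hF

omit [∀ γ : (AdelicGroupData.units K D).Adelic, MeasurableSpace ((AdelicGroupData.units K D).Adelic ⧸
    Subgroup.centralizer ({γ} : Set (AdelicGroupData.units K D).Adelic))]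
  [∀ γ : (AdelicGroupData.units K D).Adelic, BorelSpace ((AdelicGroupData.units K D).Adelic ⧸
    Subgroup.centralizer ({γ} : Set (AdelicGroupData.units K D).Adelic))]
  [∀ γ : (AdelicGroupData.units K D).Adelic, MeasurableSpace
    (↥(Subgroup.centralizer ({γ} : Set (AdelicGroupData.units K D).Adelic)) ⧸
      ((AdelicGroupData.units K D).quotientSubgroup ⊓
        Subgroup.centralizer ({γ} : Set (AdelicGroupData.units K D).Adelic)).subgroupOf
        (Subgroup.centralizer ({γ} : Set (AdelicGroupData.units K D).Adelic)))]
  [∀ γ : (AdelicGroupData.units K D).Adelic, BorelSpace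
    (↥(Subgroup.centralizer ({γ} : Set (AdelicGroupData.units K D).Adelic)) ⧸
      ((AdelicGroupData.units K D).quotientSubgroup ⊓
        Subgroup.centralizer ({γ} : Set (AdelicGroupData.units K D).Adelic)).subgroupOf
        (Subgroup.centralizer ({γ} : Set (AdelicGroupData.units K D).Adelic)))] in
/-- **The restricted Haar measures exist** (non-vacuity of the parameters `ρ_{H,c}`, `ρ_{F,c}` of
the trace formula below): for a Haar measure `α` on `A_G = ℝ_{>0}`, the restriction
`ρ_{H,c} = (α ⊗ counting)|_{H_c}` of the Haar measure `((a, γ) ↦ a γ)_* (α ⊗ counting)` of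
`L = ℝ_{>0} Dˣ` to `H_c = L ∩ C_G(γ_c)` (relatively open in `L`) is a Haar measure of `H_c`,
inversion invariant and s-finite, and so is its transport `ρ_{F,c}` to `H_c ≤ G_c`
(`isHaarMeasure_comap_subgroupInclusion`, `isInvInvariant_comap`, `isInvInvariant_map_mulEquiv`).
[folklore] -/
theorem units_exists_restricted_haar
    [LocallyCompactSpace (GD).Adelic] [SecondCountableTopology (GD).Adelic] [T2Space (GD).Adelic]
    [hH : IsClosed ((GD).quotientSubgroup : Set (GD).Adelic)]
    [hCcl : ∀ γ : (GD).Adelic, IsClosed ((Subgroup.centralizer ({γ} : Set (GD).Adelic) :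
      Subgroup (GD).Adelic) : Set (GD).Adelic)]
    (α : Measure (GD).center') [α.IsHaarMeasure] [SFinite α] :
    ∃ (ρH : ∀ c : ConjClasses (GD).arithmeticSubgroup, Measure ↥((GD).quotientSubgroup ⊓
        Subgroup.centralizer ({((Quotient.out c : (GD).arithmeticSubgroup) : (GD).Adelic)} :
          Set (GD).Adelic)))
      (ρF : ∀ c : ConjClasses (GD).arithmeticSubgroup, Measure ↥(((GD).quotientSubgroup ⊓
        Subgroup.centralizer ({((Quotient.out c : (GD).arithmeticSubgroup) : (GD).Adelic)} :
          Set (GD).Adelic)).subgroupOf (Subgroup.centralizer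
            ({((Quotient.out c : (GD).arithmeticSubgroup) : (GD).Adelic)} : Set (GD).Adelic)))),
      (∀ c, IsHaarMeasure (ρH c)) ∧ (∀ c, (ρH c).IsInvInvariant) ∧ (∀ c, SFinite (ρH c)) ∧
      (∀ c, IsHaarMeasure (ρF c)) ∧ (∀ c, (ρF c).IsInvInvariant) ∧ (∀ c, SFinite (ρF c)) ∧
      (∀ c, ρH c = (Measure.map (fun p : (GD).center' × (GD).arithmeticSubgroup =>
        (⟨(p.1 : (GD).Adelic) * p.2, AdelicGroupData.mulMap_mem (GD) p⟩ : (GD).quotientSubgroup))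
          (α.prod count)).comap (Subgroup.inclusion inf_le_left)) ∧
      (∀ c, ρF c = Measure.map (Subgroup.subgroupOfEquivOfLe inf_le_right).symm (ρH c)) := by
  have h4 : Module.finrank K D = 4 := IsQuaternionAlgebra.finrank_eq_four (K := K) (D := D)
  haveI : Nontrivial D := Module.nontrivial_of_finrank_pos (R := K) (by omega)
  haveI : Countable (GD).arithmeticSubgroup := AdelicGroupData.countable_arithmeticSubgroup_units K D
  have hdisc : (GD).IsDiscreteRational := AdelicGroupData.units_isDiscreteRational_holds K D
  haveI : LocallyCompactSpace (AdeleRing (𝓞 K) K) := locallyCompactSpace_adeleRing' K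
  obtain ⟨θ, hθc, hθA, hθa, hθγ⟩ := exists_centralRetraction_units K D
  set ρ₀ : Measure (GD).quotientSubgroup := Measure.map
    (fun p : (GD).center' × (GD).arithmeticSubgroup =>
      (⟨(p.1 : (GD).Adelic) * p.2, AdelicGroupData.mulMap_mem (GD) p⟩ : (GD).quotientSubgroup))
    (α.prod count) with hρ₀
  haveI : ρ₀.IsHaarMeasure :=
    AdelicGroupData.isHaarMeasure_map_mul_prod_count (GD) hdisc θ hθc hθA hθa hθγ α
  haveI : ρ₀.IsMulRightInvariant := AdelicGroupData.isMulRightInvariant_quotientSubgroup_units K D ρ₀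
  haveI : ρ₀.IsInvInvariant := isInvInvariant_of_isMulRightInvariant ρ₀
  haveI hHcl : ∀ c : ConjClasses (GD).arithmeticSubgroup,
      IsClosed ((((GD).quotientSubgroup ⊓ Subgroup.centralizer
        ({((Quotient.out c : (GD).arithmeticSubgroup) : (GD).Adelic)} : Set (GD).Adelic)) :
          Subgroup (GD).Adelic) : Set (GD).Adelic) := fun c =>
    hH.inter (hCcl _)
  have hopen : ∀ c : ConjClasses (GD).arithmeticSubgroup,
      IsOpen (((((GD).quotientSubgroup ⊓ Subgroup.centralizer
        ({((Quotient.out c : (GD).arithmeticSubgroup) : (GD).Adelic)} :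
          Set (GD).Adelic)).subgroupOf (GD).quotientSubgroup : Subgroup (GD).quotientSubgroup)) :
            Set (GD).quotientSubgroup) := fun c =>
    AdelicGroupData.isOpen_subgroupOf_quotientSubgroup_of_center'_le (GD) hdisc θ hθc hθA hθa hθγ
      (AdelicGroupData.center'_le_inf_centralizer (GD) _)
  set ρH : ∀ c : ConjClasses (GD).arithmeticSubgroup, Measure ↥((GD).quotientSubgroup ⊓
      Subgroup.centralizer ({((Quotient.out c : (GD).arithmeticSubgroup) : (GD).Adelic)} :
        Set (GD).Adelic)) := fun c => ρ₀.comap (Subgroup.inclusion inf_le_left) with hρH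
  haveI hHa : ∀ c, IsHaarMeasure (ρH c) := fun c =>
    isHaarMeasure_comap_subgroupInclusion _ _ inf_le_left (hopen c) ρ₀
  haveI hHi : ∀ c, (ρH c).IsInvInvariant := fun c =>
    isInvInvariant_comap (Subgroup.inclusion inf_le_left)
      (measurableEmbedding_subgroupInclusion _ _ inf_le_left (hHcl c)) ρ₀
  haveI hHs : ∀ c, SFinite (ρH c) := fun c => inferInstance
  set ρF : ∀ c : ConjClasses (GD).arithmeticSubgroup, Measure ↥(((GD).quotientSubgroup ⊓
      Subgroup.centralizer ({((Quotient.out c : (GD).arithmeticSubgroup) : (GD).Adelic)} :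
        Set (GD).Adelic)).subgroupOf (Subgroup.centralizer
          ({((Quotient.out c : (GD).arithmeticSubgroup) : (GD).Adelic)} : Set (GD).Adelic))) :=
    fun c => Measure.map (Subgroup.subgroupOfEquivOfLe (inf_le_right :
      (GD).quotientSubgroup ⊓ Subgroup.centralizer
        ({((Quotient.out c : (GD).arithmeticSubgroup) : (GD).Adelic)} : Set (GD).Adelic) ≤ _)).symm
      (ρH c) with hρF
  have hFa : ∀ c, IsHaarMeasure (ρF c) := fun c =>
    MulEquiv.isHaarMeasure_map (ρH c) _ (continuous_subgroupOfEquivOfLe_symm _ _ inf_le_right)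
      (continuous_subgroupOfEquivOfLe _ _ inf_le_right)
  have hFi : ∀ c, (ρF c).IsInvInvariant := fun c =>
    isInvInvariant_map_mulEquiv _ (continuous_subgroupOfEquivOfLe_symm _ _ inf_le_right).measurable
      (ρH c)
  have hFs : ∀ c, SFinite (ρF c) := fun c => inferInstance
  exact ⟨ρH, ρF, hHa, hHi, hHs, hFa, hFi, hFs, fun c => rfl, fun c => rfl⟩

/-- **The trace formula for `D^×` in Hilbert–Schmidt form, with the printed constants** (Gelbart
(1975), Remark 9.23 and (10.14): `tr R'(Φ') = Σ_{{γ}} meas(Z'_𝔸 G'(γ)_F \ G'(γ)_𝔸)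
∫_{G'(γ)_𝔸 \ G'_𝔸} Φ'(x⁻¹ γ x) dx`, applied to `Φ' = f ⋆ f^*`, for which `tr R'(f ⋆ f^*) = Σ_i ‖R'(f) e_i‖²`
— Gelbart (9.11) with Lemma 10.6). Let `D` be a division quaternion algebra over the number field
`K`, `𝒢 = AdelicGroupData.units K D` (`G = D_𝔸ˣ`, `Γ = Dˣ`, `L = ℝ_{>0} Dˣ`, `X = G ⧸ L` compact), `μ`
an automorphic measure, `α` a Haar measure on `A_G = ℝ_{>0}`, `ν` a Haar measure on `G` (two-sided,
inversion invariant: `units_isMulRightInvariant_of_isHaarMeasure`, `units_isInvInvariant_of_isHaarMeasure`);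
for each conjugacy class `c` of `Γ`: `γ_c = out c`, `G_c = C_G(γ_c)`, `H_c = L ∩ G_c = ℝ_{>0} Dˣ_{γ_c}`,
`ν_c` any Haar measure on `G_c` (two-sided and inversion invariant by
`units_isMulRightInvariant_centralizer`, `units_isInvInvariant_centralizer`),
`ρ_{H,c} = (α ⊗ counting)|_{H_c}` the restriction to `H_c` of the Haar measure
`((a, γ) ↦ a γ)_* (α ⊗ counting)` of `L` (`Measure.comap` along `H_c ↪ L`) and `ρ_{F,c}` its
transport to `H_c ≤ G_c` (these exist: `units_exists_restricted_haar`). Then for every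
`f ∈ C_c(D_𝔸ˣ)` and every Hilbert basis `(e_i)` of `L²(X, μ)`:

  `Σ_i ‖R(f) e_i‖² = Σ'_c vol(G_c ⧸ H_c) · ∫_{G ⧸ G_c} (f ⋆ f^*)_A(y γ_c y⁻¹) d(ν/ν_c)(y)`,

where `R(f) = ∫_G f(g) R(g) dν(g)`, `(f ⋆ f^*)(g) = ∫_G f(u) conj(f(g⁻¹ u)) dν(u)`,
`Φ_A(g) = ∫_{A_G} Φ(a⁻¹ g) dα(a)`, `ν/ν_c = quotientMeasure G_c ν_c ν` (Weil constant one) and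
`vol(G_c ⧸ H_c) = (quotientMeasure (H_c ⊓ G_c) ρ_{F,c} ν_c)(G_c ⧸ H_c) ∈ (0, ∞)` — Gelbart's
`meas(Z_∞⁺ G(γ)_ℚ \ G(γ)_𝔸)` for the measures `ν_c` on `G(γ)_𝔸` and `α ⊗ counting` on `Z_∞⁺ G(γ)_ℚ`.
No unspecified constant remains: the normalisations of `μ` and of the Haar measure of `L` cancel
(`c⁻¹ · c`), those of the `ν_c` cancel between volume and orbital integral, and the left-hand side
depends on `ν` alone. Assembled from `hasSum_norm_sq_integratedOperator_rightRegular_eq_diagonal`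
(Gelbart (9.11)), `integral_quotientKernel_diag_eq_mul_tsum` (absolute convergence and the passage
to `ℂ`) and `units_lintegral_conjTsum_eq_mul_tsum_covol_mul` (the printed volumes). Not treated
here: the spectral side `Σ_π m(π) tr π(f) π(f)^*` (see `HilbertRepHilbertSchmidtBlocks`) and the
comparison with `GL(2)` ((10.15)). [cite: Gelbart1975, Remark 9.23 and (10.14)] -/
theorem units_hasSum_norm_sq_integratedOperator_eq_tsum_covol_mul
    (hdiv : ∀ x : D, x ≠ 0 → IsUnit x)
    [LocallyCompactSpace (GD).Adelic] [SecondCountableTopology (GD).Adelic] [T2Space (GD).Adelic]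
    [hH : IsClosed ((GD).quotientSubgroup : Set (GD).Adelic)]
    [hCcl : ∀ γ : (GD).Adelic, IsClosed ((Subgroup.centralizer ({γ} : Set (GD).Adelic) :
      Subgroup (GD).Adelic) : Set (GD).Adelic)]
    (μ : Measure (GD).automorphicQuotient) [(GD).IsAutomorphicMeasure μ]
    (α : Measure (GD).center') [α.IsHaarMeasure] [SFinite α]
    (ν : Measure (GD).Adelic) [IsHaarMeasure ν] [ν.IsMulRightInvariant] [ν.IsInvInvariant]
    (ρH : ∀ c : ConjClasses (GD).arithmeticSubgroup, Measure ↥((GD).quotientSubgroup ⊓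
      Subgroup.centralizer ({((Quotient.out c : (GD).arithmeticSubgroup) : (GD).Adelic)} :
        Set (GD).Adelic)))
    [∀ c, IsHaarMeasure (ρH c)] [∀ c, (ρH c).IsInvInvariant] [∀ c, SFinite (ρH c)]
    (ρF : ∀ c : ConjClasses (GD).arithmeticSubgroup, Measure ↥(((GD).quotientSubgroup ⊓
      Subgroup.centralizer ({((Quotient.out c : (GD).arithmeticSubgroup) : (GD).Adelic)} :
        Set (GD).Adelic)).subgroupOf (Subgroup.centralizer
          ({((Quotient.out c : (GD).arithmeticSubgroup) : (GD).Adelic)} : Set (GD).Adelic))))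
    [∀ c, IsHaarMeasure (ρF c)] [∀ c, (ρF c).IsInvInvariant] [∀ c, SFinite (ρF c)]
    (νC : ∀ c : ConjClasses (GD).arithmeticSubgroup, Measure ↥(Subgroup.centralizer
      ({((Quotient.out c : (GD).arithmeticSubgroup) : (GD).Adelic)} : Set (GD).Adelic)))
    [∀ c, IsHaarMeasure (νC c)] [∀ c, (νC c).IsMulRightInvariant] [∀ c, (νC c).IsInvInvariant]
    [∀ c, SFinite (νC c)]
    (hρH : ∀ c, ρH c = (Measure.map (fun p : (GD).center' × (GD).arithmeticSubgroup =>
      (⟨(p.1 : (GD).Adelic) * p.2, AdelicGroupData.mulMap_mem (GD) p⟩ : (GD).quotientSubgroup))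
        (α.prod count)).comap (Subgroup.inclusion inf_le_left))
    (hρF : ∀ c, ρF c = Measure.map (Subgroup.subgroupOfEquivOfLe inf_le_right).symm (ρH c))
    (f : CompactlySupportedContinuousMap (GD).Adelic ℂ) {ι : Type*} [Countable ι]
    (b : HilbertBasis ι ℂ ((GD).L2 μ)) :
    HasSum (fun i => ((‖((GD).rightRegular μ).integratedOperator ((GD).isUnitary_rightRegular μ)
        ((GD).isStronglyContinuous_rightRegular_holds μ) ν f (b i)‖ ^ 2 : ℝ) : ℂ))
      (∑' c : ConjClasses (GD).arithmeticSubgroup,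
        (((quotientMeasure (((GD).quotientSubgroup ⊓ Subgroup.centralizer
            ({((Quotient.out c : (GD).arithmeticSubgroup) : (GD).Adelic)} : Set (GD).Adelic)).subgroupOf
            (Subgroup.centralizer ({((Quotient.out c : (GD).arithmeticSubgroup) : (GD).Adelic)} :
              Set (GD).Adelic))) (ρF c) (isClosed_subgroupOf _ _ (hH.inter (hCcl _))) (νC c)
            Set.univ).toReal : ℝ) : ℂ) *
          ∫ y, descConj ((Quotient.out c : (GD).arithmeticSubgroup) : (GD).Adelic)
            (Subgroup.centralizer ({((Quotient.out c : (GD).arithmeticSubgroup) : (GD).Adelic)} :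
              Set (GD).Adelic)) (mem_centralizer_singleton_comm _)
            (fun g => ∫ a, mulConv ν f (mulStar f) ((a : (GD).Adelic)⁻¹ * g) ∂α) y
            ∂quotientMeasure (Subgroup.centralizer
              ({((Quotient.out c : (GD).arithmeticSubgroup) : (GD).Adelic)} : Set (GD).Adelic))
              (νC c) (hCcl _) ν) := by
  have h4 : Module.finrank K D = 4 := IsQuaternionAlgebra.finrank_eq_four (K := K) (D := D)
  haveI : Nontrivial D := Module.nontrivial_of_finrank_pos (R := K) (by omega)
  haveI : Countable (GD).arithmeticSubgroup := AdelicGroupData.countable_arithmeticSubgroup_units K D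
  have hdisc : (GD).IsDiscreteRational := AdelicGroupData.units_isDiscreteRational_holds K D
  haveI : LocallyCompactSpace (AdeleRing (𝓞 K) K) := locallyCompactSpace_adeleRing' K
  obtain ⟨θ, hθc, hθA, hθa, hθγ⟩ := exists_centralRetraction_units K D
  haveI hX : CompactSpace (GD).automorphicQuotient :=
    AdelicGroupData.compactSpace_automorphicQuotient_units_holds K D hdiv
  -- the Haar measure `ρ₀ = ((a, γ) ↦ a γ)_* (α ⊗ counting)` of `L`
  set ρ₀ : Measure (GD).quotientSubgroup := Measure.map
    (fun p : (GD).center' × (GD).arithmeticSubgroup =>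
      (⟨(p.1 : (GD).Adelic) * p.2, AdelicGroupData.mulMap_mem (GD) p⟩ : (GD).quotientSubgroup))
    (α.prod count) with hρ₀
  haveI : ρ₀.IsHaarMeasure :=
    AdelicGroupData.isHaarMeasure_map_mul_prod_count (GD) hdisc θ hθc hθA hθa hθγ α
  haveI : ρ₀.IsMulRightInvariant := AdelicGroupData.isMulRightInvariant_quotientSubgroup_units K D ρ₀
  haveI : ρ₀.IsInvInvariant := isInvInvariant_of_isMulRightInvariant ρ₀
  have hρ0 : ρ₀ ≠ 0 := fun h => by
    have h2 : 0 < ρ₀ Set.univ := isOpen_univ.measure_pos ρ₀ ⟨1, trivial⟩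
    rw [h] at h2
    exact lt_irrefl _ h2
  have hκ : ρ₀ = (1 : ℝ≥0) • Measure.map
      (fun p : (GD).center' × (GD).arithmeticSubgroup =>
        (⟨(p.1 : (GD).Adelic) * p.2, AdelicGroupData.mulMap_mem (GD) p⟩ : (GD).quotientSubgroup))
      (α.prod count) := by rw [one_smul]
  -- the constants `d_c = c_μ · vol(G_c ⧸ H_c)` and the measures `ν/ν_c`
  set cμ : ℝ≥0∞ := (unfoldingConstant (GD).quotientSubgroup ρ₀ μ ν : ℝ≥0∞) with hcμ
  have hcμ0 : cμ ≠ 0 := ENNReal.coe_ne_zero.2 (unfoldingConstant_pos (GD).quotientSubgroup ρ₀ μ ν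
    (AdelicGroupData.IsAutomorphicMeasure.ne_zero (GD) μ) hρ0).ne'
  have hrep : ∀ c : ConjClasses (GD).arithmeticSubgroup,
      ConjClasses.mk (Quotient.out c : (GD).arithmeticSubgroup) = c := fun c => by
    rw [← ConjClasses.quotient_mk_eq_mk]; exact Quotient.out_eq c
  haveI : ∀ c : ConjClasses (GD).arithmeticSubgroup,
      IsClosed ((((GD).quotientSubgroup ⊓ Subgroup.centralizer
        ({((Quotient.out c : (GD).arithmeticSubgroup) : (GD).Adelic)} : Set (GD).Adelic)) :
          Subgroup (GD).Adelic) : Set (GD).Adelic) := fun c =>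
    hH.inter (hCcl _)
  haveI : ∀ c : ConjClasses (GD).arithmeticSubgroup,
      CompactSpace (↥(Subgroup.centralizer ({((Quotient.out c : (GD).arithmeticSubgroup) :
        (GD).Adelic)} : Set (GD).Adelic)) ⧸ ((GD).quotientSubgroup ⊓
        Subgroup.centralizer ({((Quotient.out c : (GD).arithmeticSubgroup) : (GD).Adelic)} :
          Set (GD).Adelic)).subgroupOf (Subgroup.centralizer
            ({((Quotient.out c : (GD).arithmeticSubgroup) : (GD).Adelic)} : Set (GD).Adelic))) :=
    fun c => units_compactSpace_centralizer_quotient K D hdiv (Quotient.out c).2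
  have hvol := fun c : ConjClasses (GD).arithmeticSubgroup =>
    Literature.MeasureTheory.Group.quotientMeasure_univ_ne_zero_ne_top (GD).arithmeticSubgroup
      (fun c => (GD).quotientSubgroup ⊓ Subgroup.centralizer
        ({((Quotient.out c : (GD).arithmeticSubgroup) : (GD).Adelic)} : Set (GD).Adelic))
      (fun c => Subgroup.centralizer
        ({((Quotient.out c : (GD).arithmeticSubgroup) : (GD).Adelic)} : Set (GD).Adelic))
      ρF νC c
  -- the `[0, ∞]`-valued identity in the shape consumed by `integral_quotientKernel_diag_eq_mul_tsum`
  have hd : ∀ F : (GD).Adelic → ℝ≥0∞, Measurable F →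
      ∫⁻ x, conjTsum (GD).quotientSubgroup ((GD).arithmeticSubgroup : Set (GD).Adelic)
          (AdelicGroupData.conj_mem_arithmeticSubgroup (GD)) F x ∂μ =
        ∑' c : ConjClasses (GD).arithmeticSubgroup,
          (cμ * quotientMeasure (((GD).quotientSubgroup ⊓ Subgroup.centralizer
            ({((Quotient.out c : (GD).arithmeticSubgroup) : (GD).Adelic)} : Set (GD).Adelic)).subgroupOf
            (Subgroup.centralizer ({((Quotient.out c : (GD).arithmeticSubgroup) : (GD).Adelic)} :
              Set (GD).Adelic))) (ρF c) (isClosed_subgroupOf _ _ (hH.inter (hCcl _))) (νC c)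
            Set.univ) *
          ∫⁻ y, descConj ((Quotient.out c : (GD).arithmeticSubgroup) : (GD).Adelic)
            (Subgroup.centralizer ({((Quotient.out c : (GD).arithmeticSubgroup) : (GD).Adelic)} :
              Set (GD).Adelic)) (mem_centralizer_singleton_comm _) F y
            ∂quotientMeasure (Subgroup.centralizer
              ({((Quotient.out c : (GD).arithmeticSubgroup) : (GD).Adelic)} : Set (GD).Adelic))
              (νC c) (hCcl _) ν := by
    intro F hF
    rw [units_lintegral_conjTsum_eq_mul_tsum_covol_mul K D hdiv μ ν ρ₀ ρH ρF νC hρH hρF hF,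
      ← ENNReal.tsum_mul_left]
    exact tsum_congr fun c => by rw [mul_assoc]
  -- `Φ = f ⋆ f^* ∈ C_c(D_𝔸ˣ)`
  set Φ : CompactlySupportedContinuousMap (GD).Adelic ℂ :=
    ⟨⟨mulConv ν f (mulStar f), continuous_mulConv ν f.continuous f.hasCompactSupport
      (continuous_mulStar f.continuous)⟩,
      hasCompactSupport_mulConv ν f.hasCompactSupport (hasCompactSupport_mulStar f.hasCompactSupport)⟩
    with hΦ
  obtain ⟨-, -, h2⟩ := AdelicGroupData.integral_quotientKernel_diag_eq_mul_tsum (GD) hdisc θ hθc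
    hθA hθa hθγ α ρ₀ hκ (fun c => Quotient.out c)
    (fun c => Subgroup.centralizer ({((Quotient.out c : (GD).arithmeticSubgroup) : (GD).Adelic)} :
      Set (GD).Adelic))
    (fun c => mem_centralizer_singleton_comm _) μ
    (fun c => quotientMeasure (Subgroup.centralizer
      ({((Quotient.out c : (GD).arithmeticSubgroup) : (GD).Adelic)} : Set (GD).Adelic))
      (νC c) (hCcl _) ν) hρ0
    (fun c => mul_ne_zero hcμ0 (hvol c).1) hd Φ
  have h1 := AdelicGroupData.hasSum_norm_sq_integratedOperator_rightRegular_eq_diagonal (GD) μ ρ₀ ν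
    hρ0 f b
  have h2' : ∫ x, quotientKernel (GD).quotientSubgroup ρ₀ (mulConv ν f (mulStar f)) x x ∂μ =
      (((1 : ℝ≥0) : ℝ) : ℂ) * ∑' c : ConjClasses (GD).arithmeticSubgroup,
        (((cμ * quotientMeasure (((GD).quotientSubgroup ⊓ Subgroup.centralizer
            ({((Quotient.out c : (GD).arithmeticSubgroup) : (GD).Adelic)} : Set (GD).Adelic)).subgroupOf
            (Subgroup.centralizer ({((Quotient.out c : (GD).arithmeticSubgroup) : (GD).Adelic)} :
              Set (GD).Adelic))) (ρF c) (isClosed_subgroupOf _ _ (hH.inter (hCcl _))) (νC c)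
            Set.univ).toReal : ℝ) : ℂ) *
          ∫ y, descConj ((Quotient.out c : (GD).arithmeticSubgroup) : (GD).Adelic)
            (Subgroup.centralizer ({((Quotient.out c : (GD).arithmeticSubgroup) : (GD).Adelic)} :
              Set (GD).Adelic)) (mem_centralizer_singleton_comm _)
            (fun g => ∫ a, mulConv ν f (mulStar f) ((a : (GD).Adelic)⁻¹ * g) ∂α) y
            ∂quotientMeasure (Subgroup.centralizer
              ({((Quotient.out c : (GD).arithmeticSubgroup) : (GD).Adelic)} : Set (GD).Adelic))
              (νC c) (hCcl _) ν := h2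
  rw [h2'] at h1
  convert h1 using 1
  rw [NNReal.coe_one, Complex.ofReal_one, one_mul, ← tsum_mul_left]
  refine tsum_congr fun c => ?_
  rw [ENNReal.toReal_mul, Complex.ofReal_mul, ← mul_assoc, ← mul_assoc]
  congr 1
  have hc' : (((unfoldingConstant (GD).quotientSubgroup ρ₀ μ ν : ℝ≥0) : ℝ) : ℂ) ≠ 0 := by
    exact_mod_cast (unfoldingConstant_pos (GD).quotientSubgroup ρ₀ μ ν
      (AdelicGroupData.IsAutomorphicMeasure.ne_zero (GD) μ) hρ0).ne'
  rw [hcμ, ENNReal.coe_toReal, inv_mul_cancel₀ hc', one_mul]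

/-- **The Hilbert–Schmidt norm of `R(f)` on `L²(D_𝔸ˣ ⧸ ℝ_{>0} Dˣ)` in `[0, ∞]`, with the printed
geometric side** (Gelbart (1975), (9.11) with Remark 9.23 / (10.14)): in the setting of
`units_hasSum_norm_sq_integratedOperator_eq_tsum_covol_mul` (division quaternion algebra `D`,
automorphic `μ`, Haar measures `α` on `ℝ_{>0}`, `ν` on `D_𝔸ˣ`, `ν_c` on the centralisers, the
restricted measures `ρ_{H,c}`, `ρ_{F,c}`), write
`V(f) = Σ'_c vol(G_c ⧸ H_c) ∫_{G ⧸ G_c} (f ⋆ f^*)_A(y γ_c y⁻¹) d(ν/ν_c)(y) ∈ ℂ` for the geometric side.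
Then `V(f)` is real (`im V(f) = 0`) and for every Hilbert basis `(e_l)` of `L²`:
`Σ'_l ‖R(f) e_l‖ₑ² = ofReal (re V(f))` — the form in which the spectral decomposition theorems of
`HilbertRepHilbertSchmidtBlocks` consume Hilbert–Schmidt sums.
[cite: Gelbart1975, Remark 9.23 and (10.14)] -/
theorem units_tsum_enorm_sq_integratedOperator_eq_ofReal
    (hdiv : ∀ x : D, x ≠ 0 → IsUnit x)
    [LocallyCompactSpace (GD).Adelic] [SecondCountableTopology (GD).Adelic] [T2Space (GD).Adelic]
    [hH : IsClosed ((GD).quotientSubgroup : Set (GD).Adelic)]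
    [hCcl : ∀ γ : (GD).Adelic, IsClosed ((Subgroup.centralizer ({γ} : Set (GD).Adelic) :
      Subgroup (GD).Adelic) : Set (GD).Adelic)]
    (μ : Measure (GD).automorphicQuotient) [(GD).IsAutomorphicMeasure μ]
    (α : Measure (GD).center') [α.IsHaarMeasure] [SFinite α]
    (ν : Measure (GD).Adelic) [IsHaarMeasure ν] [ν.IsMulRightInvariant] [ν.IsInvInvariant]
    (ρH : ∀ c : ConjClasses (GD).arithmeticSubgroup, Measure ↥((GD).quotientSubgroup ⊓
      Subgroup.centralizer ({((Quotient.out c : (GD).arithmeticSubgroup) : (GD).Adelic)} :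
        Set (GD).Adelic)))
    [∀ c, IsHaarMeasure (ρH c)] [∀ c, (ρH c).IsInvInvariant] [∀ c, SFinite (ρH c)]
    (ρF : ∀ c : ConjClasses (GD).arithmeticSubgroup, Measure ↥(((GD).quotientSubgroup ⊓
      Subgroup.centralizer ({((Quotient.out c : (GD).arithmeticSubgroup) : (GD).Adelic)} :
        Set (GD).Adelic)).subgroupOf (Subgroup.centralizer
          ({((Quotient.out c : (GD).arithmeticSubgroup) : (GD).Adelic)} : Set (GD).Adelic))))
    [∀ c, IsHaarMeasure (ρF c)] [∀ c, (ρF c).IsInvInvariant] [∀ c, SFinite (ρF c)]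
    (νC : ∀ c : ConjClasses (GD).arithmeticSubgroup, Measure ↥(Subgroup.centralizer
      ({((Quotient.out c : (GD).arithmeticSubgroup) : (GD).Adelic)} : Set (GD).Adelic)))
    [∀ c, IsHaarMeasure (νC c)] [∀ c, (νC c).IsMulRightInvariant] [∀ c, (νC c).IsInvInvariant]
    [∀ c, SFinite (νC c)]
    (hρH : ∀ c, ρH c = (Measure.map (fun p : (GD).center' × (GD).arithmeticSubgroup =>
      (⟨(p.1 : (GD).Adelic) * p.2, AdelicGroupData.mulMap_mem (GD) p⟩ : (GD).quotientSubgroup))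
        (α.prod count)).comap (Subgroup.inclusion inf_le_left))
    (hρF : ∀ c, ρF c = Measure.map (Subgroup.subgroupOfEquivOfLe inf_le_right).symm (ρH c))
    (f : CompactlySupportedContinuousMap (GD).Adelic ℂ) {ι : Type*} [Countable ι]
    (b : HilbertBasis ι ℂ ((GD).L2 μ)) :
    ∑' i, ‖((GD).rightRegular μ).integratedOperator ((GD).isUnitary_rightRegular μ)
        ((GD).isStronglyContinuous_rightRegular_holds μ) ν f (b i)‖ₑ ^ 2 =
      ENNReal.ofReal (∑' c : ConjClasses (GD).arithmeticSubgroup,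
        (((quotientMeasure (((GD).quotientSubgroup ⊓ Subgroup.centralizer
            ({((Quotient.out c : (GD).arithmeticSubgroup) : (GD).Adelic)} : Set (GD).Adelic)).subgroupOf
            (Subgroup.centralizer ({((Quotient.out c : (GD).arithmeticSubgroup) : (GD).Adelic)} :
              Set (GD).Adelic))) (ρF c) (isClosed_subgroupOf _ _ (hH.inter (hCcl _))) (νC c)
            Set.univ).toReal : ℝ) : ℂ) *
          ∫ y, descConj ((Quotient.out c : (GD).arithmeticSubgroup) : (GD).Adelic)
            (Subgroup.centralizer ({((Quotient.out c : (GD).arithmeticSubgroup) : (GD).Adelic)} :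
              Set (GD).Adelic)) (mem_centralizer_singleton_comm _)
            (fun g => ∫ a, mulConv ν f (mulStar f) ((a : (GD).Adelic)⁻¹ * g) ∂α) y
            ∂quotientMeasure (Subgroup.centralizer
              ({((Quotient.out c : (GD).arithmeticSubgroup) : (GD).Adelic)} : Set (GD).Adelic))
              (νC c) (hCcl _) ν).re ∧
      (∑' c : ConjClasses (GD).arithmeticSubgroup,
        (((quotientMeasure (((GD).quotientSubgroup ⊓ Subgroup.centralizer
            ({((Quotient.out c : (GD).arithmeticSubgroup) : (GD).Adelic)} : Set (GD).Adelic)).subgroupOf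
            (Subgroup.centralizer ({((Quotient.out c : (GD).arithmeticSubgroup) : (GD).Adelic)} :
              Set (GD).Adelic))) (ρF c) (isClosed_subgroupOf _ _ (hH.inter (hCcl _))) (νC c)
            Set.univ).toReal : ℝ) : ℂ) *
          ∫ y, descConj ((Quotient.out c : (GD).arithmeticSubgroup) : (GD).Adelic)
            (Subgroup.centralizer ({((Quotient.out c : (GD).arithmeticSubgroup) : (GD).Adelic)} :
              Set (GD).Adelic)) (mem_centralizer_singleton_comm _)
            (fun g => ∫ a, mulConv ν f (mulStar f) ((a : (GD).Adelic)⁻¹ * g) ∂α) y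
            ∂quotientMeasure (Subgroup.centralizer
              ({((Quotient.out c : (GD).arithmeticSubgroup) : (GD).Adelic)} : Set (GD).Adelic))
              (νC c) (hCcl _) ν).im = 0 := by
  have h := units_hasSum_norm_sq_integratedOperator_eq_tsum_covol_mul K D hdiv μ α ν ρH ρF νC hρH
    hρF f b
  have h2 := tsum_ofReal_eq_ofReal_re_of_hasSum (fun i => sq_nonneg _) h
  refine ⟨?_, h2.2⟩
  rw [← h2.1]
  refine tsum_congr fun i => ?_
  rw [← ofReal_norm, ← ENNReal.ofReal_pow (norm_nonneg _)]

end Normalized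

end Literature.NumberTheory.Automorphic
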